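import Summits.BirchSwinnertonDyer.BirchSwinnertonDyer.Theorems.KolyvaginRoadThreeMethod2KolyvaginLocalFrobenius
import Literature.NumberTheory.EllipticCurves.HeegnerPointsKolyvaginProp81FrobeniusProofs
import Literature.NumberTheory.GaloisRepresentations.AbsGaloisOuterConj
import Literature.NumberTheory.GaloisRepresentations.ImaginaryQuadraticCyclotomicProofs
import Literature.NumberTheory.GaloisRepresentations.AbsIntegersEquiv
import HarnessLib

/-!
# KOLY method line, crux stmt-BirchSwinnertonDyer-19574 `ZhangSharpFrameAtThreeHL`, stub S2-ENGINE: W. ZHANG'S KOLYVAGIN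
# PRIMES AT `p = 3` ARE GROSS'S — `Frob(ℓ) = Frob(∞)` in `Gal(K(E₃)/ℚ)` from `3 ∣ a_ℓ`, `3 ∣ ℓ + 1` and `ρ̄` onto
# (cell `bsd-stepL`, seat `bsd-stepL-zhang3-p1` g9; `--supports 19574`, helper; bridge to the tree's Gross §8 machinery)

HONEST FRAMING. Theorems only (0 definitions, 0 named facts, 0 `sorry`); closes nothing (T7). PARTITION: O2@3 (B10) ×
A1 × crux 19574 × stub S2-ENGINE — types-the-object-of (dictionary between the two Kolyvagin-prime notions of the tree at
the HL frame, so that Gross's Prop. 8.1 machinery `exists_frobeniusLift_of_isKolyvaginPrime`, `torsionMap_h1Eval_*`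
applies to the primes indexing the S2 level systems).

WHAT. The tree has two notions of Kolyvagin prime: Gross's `IsKolyvaginPrime N W K p ℓ` ((3.1) + (3.2) `Frob(ℓ) =
Frob(∞)` as conjugacy classes in `Gal(K(E_p)/ℚ)`, predicate `FrobEqFrobInfty`) and W. Zhang's `Zhang2014.IsKolyvaginPrime
N W K p ℓ` ((3.1) + the congruences `M(ℓ) > 0`, i.e. (3.3) `p ∣ ℓ + 1`, `p ∣ a_ℓ`). Gross → Zhang is the tree's
`zhang_isKolyvaginPrime_of_frobEqFrobInfty`. HERE, Zhang → Gross at `p = 3` when `ρ̄_{E,3}` is ONTO (the HL frame):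
* `frobEqFrobInfty_three_of_zhang` — `FrobEqFrobInfty W K 3 ℓ`. Proof: a complex conjugation `c₀ ∈ Γ_ℚ` and a Frobenius
  `h₀` above `ℓ` both act on `E[3]` as NON-SCALAR INVOLUTIONS (`c₀² = 1`, `det = χ̄₃(c₀) = −1`, both eigenlines non-zero:
  tree `RatClosure.exists_eigenvectors`; `h₀² = 1` by Cayley–Hamilton `KolyLocal.frob_sq_smul_eq_self`, `det h₀ = ℓ ≡
  −1`); two such are conjugate in `GL(E[3])` (bases of eigenvectors, `Basis.equiv`), and the conjugator lifts to `g ∈ Γ_ℚ`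
  by SURJECTIVITY of `ρ̄`; `h = g h₀ g⁻¹` is a Frobenius above `ℓ` (`IsArithFrobAt.conj`) equal to `c₀` on `E[3]`; on `K`
  both `h` and `c₀` restrict to the non-trivial automorphism (`ℓ` inert: a Frobenius in `res Γ_K` would force residue
  degree `1`, `inertiaDeg_eq_one_of_isArithFrobAt_absGaloisRestrict`; `c₀ ∉ res Γ_K` for `K` totally complex), so
  `c₀⁻¹ h ∈ res Γ_K` fixes every `ℚ`-embedded copy of `K`.
* `isKolyvaginPrime_three_of_zhang` — Gross's `IsKolyvaginPrime (W.conductorNorm ℤ) W K 3 ℓ`.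

References: [cite: GrossLMS1991, §3 (3.1)–(3.3)] [cite: WZhang2014, Notations (xii)] [cite: Serre1972, §4 (image of ρ̄)]
[cite: NeukirchANT1999, Ch. I §9 Prop. (9.4)–(9.6)].
-/

noncomputable section

open scoped Classical Pointwise

namespace Summit.BirchSwinnertonDyer.Rank1Residual.X11b.Three.Koly.Method2.KolyLocal

open WeierstrassCurve Field Function NumberField IsDedekindDomain Rat.HeightOneSpectrum
open Literature.NumberTheory.EllipticCurves Literature.NumberTheory.GaloisRepresentations Module
open Summit.BirchSwinnertonDyer.Rank1Residual.X11b.Three.Koly.Method2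

variable (W : WeierstrassCurve ℚ) [W.IsElliptic] [W.IsGloballyMinimal]

omit [W.IsGloballyMinimal] in
/-- **Two elements of `Γ_ℚ` acting on `E[3](ℚ̄)` with eigenvectors of both signs are conjugate on `E[3]` when `ρ̄_{E,3}`
is onto**: if `a, b ∈ Γ_ℚ` act on `E[3]`, each with a non-zero fixed vector and a non-zero anti-fixed
vector, then `g a g⁻¹ = b` on `E[3]` for some `g ∈ Γ_ℚ` (eigenbases `{a₊, a₋}`, `{b₊, b₋}` of the `𝔽₃`-plane `E[3]`,
the conjugator `a± ↦ b±` (`Basis.equiv`), lifted along the surjection `ρ̄ : Γ_ℚ → Aut(E[3])`). [folklore] -/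
theorem exists_conj_smul_eq_of_involutions (hsurj : W.HasSurjectiveModNGaloisRep ((3 : ℕ) : ℤ))
    {a b : absoluteGaloisGroup ℚ} {a₁ a₂ b₁ b₂ : geomTorsion W ((3 : ℕ) : ℤ)} (ha₁ : a • a₁ = a₁) (ha₁0 : a₁ ≠ 0) (ha₂ : a • a₂ = -a₂)
    (ha₂0 : a₂ ≠ 0) (hb₁ : b • b₁ = b₁) (hb₁0 : b₁ ≠ 0) (hb₂ : b • b₂ = -b₂) (hb₂0 : b₂ ≠ 0) :
    ∃ g : absoluteGaloisGroup ℚ, ∀ P : geomTorsion W ((3 : ℕ) : ℤ), g • a • g⁻¹ • P = b • P := by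
  haveI : Fact (Nat.Prime 3) := ⟨Nat.prime_three⟩
  letI : Module (ZMod 3) (geomTorsion W ((3 : ℕ) : ℤ)) := AddSubgroup.torsionBy.zmodModule
  have h2 : Module.finrank (ZMod 3) (geomTorsion W ((3 : ℕ) : ℤ)) = 2 :=
    Literature.RepresentationTheory.FiniteGroups.Representation.finrank_eq_two_of_natCard_eq_sq
      (card_torsionPoints_eq_sq_holds W (AlgebraicClosure ℚ) (n := 3) (by norm_num))
  haveI : FiniteDimensional (ZMod 3) (geomTorsion W ((3 : ℕ) : ℤ)) := Module.finite_of_finrank_eq_succ h2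
  -- the `ZMod 3`-linear maps of `a`, `b`
  set fa := (galoisRepTorsion W ((3 : ℕ) : ℤ) a).toAdd.toAddMonoidHom.toZModLinearMap 3 with hfadef
  set fb := (galoisRepTorsion W ((3 : ℕ) : ℤ) b).toAdd.toAddMonoidHom.toZModLinearMap 3 with hfbdef
  have hfa : ∀ Q, fa Q = a • Q := fun Q => rfl
  have hfb : ∀ Q, fb Q = b • Q := fun Q => rfl
  -- `3 x = 0`
  have h3 : ∀ x : geomTorsion W ((3 : ℕ) : ℤ), x + x + x = 0 := fun x ↦ by
    have h3x : (3 : ℕ) • x = 0 := AddSubgroup.torsionBy.nsmul x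
    rwa [show (3 : ℕ) • x = x + x + x by rw [succ_nsmul, two_nsmul]] at h3x
  -- eigenvectors for `+1`/`−1` of a linear map are linearly independent (`1 ≠ −1` in `𝔽₃`)
  have hli : ∀ (φ : geomTorsion W ((3 : ℕ) : ℤ) →ₗ[ZMod 3] geomTorsion W ((3 : ℕ) : ℤ))
      {x₁ x₂ : geomTorsion W ((3 : ℕ) : ℤ)}, φ x₁ = x₁ → x₁ ≠ 0 →
      φ x₂ = -x₂ → x₂ ≠ 0 → LinearIndependent (ZMod 3) ![x₁, x₂] := by
    intro φ x₁ x₂ hx₁ hx₁0 hx₂ hx₂0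
    rw [LinearIndependent.pair_iff]
    intro c d hcd
    have hs : φ (c • x₁ + d • x₂) = c • x₁ - d • x₂ := by
      rw [map_add, map_smul, map_smul, hx₁, hx₂, smul_neg, sub_eq_add_neg]
    rw [hcd, map_zero] at hs
    -- `c • x₁ - d • x₂ = 0` and `c • x₁ + d • x₂ = 0` give `c • x₁ = 0 = d • x₂`
    have hc2 : c • x₁ + c • x₁ = 0 := by
      have := congrArg₂ (· + ·) hcd hs.symm
      simp only [add_zero] at this
      rw [← this]; abel
    have hc1 : c • x₁ = 0 := by
      have := h3 (c • x₁)
      rw [hc2, zero_add] at this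
      exact this
    have hd1 : d • x₂ = 0 := by rw [hc1, zero_add] at hcd; exact hcd
    exact ⟨(smul_eq_zero.mp hc1).resolve_right hx₁0, (smul_eq_zero.mp hd1).resolve_right hx₂0⟩
  have hcard : Fintype.card (Fin 2) = Module.finrank (ZMod 3) (geomTorsion W ((3 : ℕ) : ℤ)) := by
    rw [Fintype.card_fin, h2]
  let bA := basisOfLinearIndependentOfCardEqFinrank
    (hli fa (by rw [hfa, ha₁]) ha₁0 (by rw [hfa, ha₂]) ha₂0) hcard
  let bB := basisOfLinearIndependentOfCardEqFinrank
    (hli fb (by rw [hfb, hb₁]) hb₁0 (by rw [hfb, hb₂]) hb₂0) hcard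
  have hbA0 : bA 0 = a₁ := by rw [coe_basisOfLinearIndependentOfCardEqFinrank]; rfl
  have hbA1 : bA 1 = a₂ := by rw [coe_basisOfLinearIndependentOfCardEqFinrank]; rfl
  have hbB0 : bB 0 = b₁ := by rw [coe_basisOfLinearIndependentOfCardEqFinrank]; rfl
  have hbB1 : bB 1 = b₂ := by rw [coe_basisOfLinearIndependentOfCardEqFinrank]; rfl
  -- the conjugator `M : a± ↦ b±`
  let M : geomTorsion W ((3 : ℕ) : ℤ) ≃ₗ[ZMod 3] geomTorsion W ((3 : ℕ) : ℤ) := bA.equiv bB (Equiv.refl _)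
  have hM0 : M a₁ = b₁ := by rw [← hbA0, Basis.equiv_apply, Equiv.refl_apply, hbB0]
  have hM1 : M a₂ = b₂ := by rw [← hbA1, Basis.equiv_apply, Equiv.refl_apply, hbB1]
  have hMA : ∀ P, M (a • P) = b • M P := by
    have hlin : M.toLinearMap ∘ₗ fa = fb ∘ₗ M.toLinearMap := by
      refine bA.ext fun i ↦ ?_
      fin_cases i
      · change M (fa (bA 0)) = fb (M (bA 0))
        rw [hfa, hfb, hbA0, ha₁, hM0, hb₁]
      · change M (fa (bA 1)) = fb (M (bA 1))
        rw [hfa, hfb, hbA1, ha₂, map_neg, hM1, hb₂]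
    intro P
    have := congrArg (fun f ↦ f P) hlin
    simpa only [LinearMap.comp_apply, LinearEquiv.coe_coe, hfa, hfb] using this
  -- lift `M` to `g ∈ Γ_ℚ`
  obtain ⟨g, hg⟩ := hsurj (Multiplicative.ofAdd M.toAddEquiv)
  have hgP : ∀ P, g • P = M P := fun P ↦ by
    have := congrArg (fun φ ↦ (Multiplicative.toAdd φ) P) hg
    simpa using this
  refine ⟨g, fun P ↦ ?_⟩
  have hg' : g⁻¹ • P = M.symm P := by
    rw [inv_smul_eq_iff, hgP, LinearEquiv.apply_symm_apply]
  rw [hg', hgP, hMA, LinearEquiv.apply_symm_apply]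

variable (K : Type) [Field K] [NumberField K]

/-- **W. Zhang's Kolyvagin primes at `3` satisfy Gross's (3.2) when `ρ̄_{E,3}` is onto**: for `K` imaginary quadratic, `W`
with `ρ̄_{E,3}` surjective and `ℓ` with `Zhang2014.IsKolyvaginPrime N W K 3 ℓ`, `Frob(ℓ) = Frob(∞)` in `Gal(K(E₃)/ℚ)`
(`FrobEqFrobInfty W K 3 ℓ`). See the module docstring. [cite: GrossLMS1991, §3 (3.2)–(3.3)] [cite: WZhang2014,
Notations (xii)] -/
theorem frobEqFrobInfty_three_of_zhang (hK : IsImaginaryQuadratic K) (hsurj : W.HasSurjectiveModNGaloisRep 3) {ℓ : ℕ}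
    (hℓ : Zhang2014.IsKolyvaginPrime (W.conductorNorm ℤ) W K 3 ℓ) : FrobEqFrobInfty W K 3 ℓ := by
  have hne1 : (-1 : ZMod 3) ≠ 1 := by decide
  haveI : Fact (Nat.Prime 3) := ⟨Nat.prime_three⟩
  haveI : Algebra.IsQuadraticExtension ℚ K := ⟨hK.1⟩
  haveI : IsTotallyComplex K := hK.2
  have hℓp : ℓ.Prime := hℓ.1
  haveI : Fact ℓ.Prime := ⟨hℓp⟩
  have hℓ3 : ℓ ≠ 3 := hℓ.2.2.2.1
  have hℓP : (Ideal.span {(ℓ : 𝓞 K)}).IsPrime := hℓ.2.2.2.2.1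
  have hdvd := Zhang2014.IsKolyvaginPrime.dvd (p := 3) hℓ
  -- ### places: `w = (ℓ)` in `K`, `v₁` below it in `ℚ`, a prime `𝔓 ∣ w` of `\bar ℤ_K`, `𝔓' = 𝔓 ∩ \bar ℤ`
  let w : HeightOneSpectrum (𝓞 K) := ⟨Ideal.span {(ℓ : 𝓞 K)}, hℓP, by
    rw [Ne, Ideal.span_singleton_eq_bot]; exact_mod_cast hℓp.ne_zero⟩
  have hw : (ℓ : 𝓞 K) ∈ w.asIdeal := Ideal.mem_span_singleton_self _
  set v₁ : HeightOneSpectrum (𝓞 ℚ) := w.under (𝓞 ℚ) with hv₁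
  have hwv₁ : w.asIdeal.under (𝓞 ℚ) = v₁.asIdeal := rfl
  have hℓv₁ : (ℓ : 𝓞 ℚ) ∈ v₁.asIdeal := by
    rw [← hwv₁, Ideal.under_def, Ideal.mem_comap, map_natCast]; exact hw
  have hv₁ℓ : (primesEquiv v₁ : ℕ) = ℓ := primesEquiv_eq_of_natCast_mem hℓp hℓv₁
  obtain ⟨𝔐, h𝔐⟩ := w.localPrimesAbove_nonempty
  set 𝔓 := w.primeBelow (closureEmb (K := K) (w.adicCompletion K)) 𝔐 with h𝔓def
  have h𝔓 : 𝔓 ∈ w.primesAbove := HeightOneSpectrum.primeBelow_mem_primesAbove h𝔐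
  set 𝔓' := 𝔓.comap (absIntegersMap ℚ K) with h𝔓'def
  have h𝔓' : 𝔓' ∈ v₁.primesAbove := comap_absIntegersMap_mem_primesAbove hwv₁ h𝔓
  have hgood : W.HasGoodReductionAtPrime ℓ :=
    (hasGoodReductionAtPrime_primesEquiv_iff_holds W v₁ ℓ hv₁ℓ).mpr
      (LocalFrob.hasGoodReductionAt_rat_of_not_dvd_conductorNorm W hℓp hℓ.2.1 v₁ hℓv₁)
  -- ### the two involutions: a Frobenius `h₀` above `ℓ` and a complex conjugation `c₀`
  obtain ⟨h₀, hh₀⟩ := HeightOneSpectrum.exists_isArithFrobAt_of_mem_primesAbove_holds h𝔓'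
  obtain ⟨c₀, hc₀⟩ := exists_isComplexConjugation (Rat.castHom ℝ)
  have hA2 : ∀ P : geomTorsion W ((3 : ℕ) : ℤ), h₀ • h₀ • P = P := fun P ↦
    frob_sq_smul_eq_self W hℓ3 hgood hdvd.1 hdvd.2 hv₁ℓ h𝔓' hh₀ P
  have hW3 : W.exists_weilPairing 3 := exists_weilPairing_holds W 3
  obtain ⟨⟨b₁, hb₁0, hb₁⟩, ⟨b₂, hb₂0, hb₂⟩⟩ := RatClosure.exists_eigenvectors W hc₀ hW3 (by norm_num)
  -- eigenvectors of `h₀`: `h₀ ≠ ±1` on `E[3]` since `det h₀ = ℓ ≡ −1`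
  letI : Module (ZMod 3) (geomTorsion W ((3 : ℕ) : ℤ)) := AddSubgroup.torsionBy.zmodModule
  have h2 : Module.finrank (ZMod 3) (geomTorsion W ((3 : ℕ) : ℤ)) = 2 :=
    Literature.RepresentationTheory.FiniteGroups.Representation.finrank_eq_two_of_natCard_eq_sq
      (card_torsionPoints_eq_sq_holds W (AlgebraicClosure ℚ) (n := 3) (by norm_num))
  haveI : FiniteDimensional (ZMod 3) (geomTorsion W ((3 : ℕ) : ℤ)) := Module.finite_of_finrank_eq_succ h2
  set f := (galoisRepTorsion W ((3 : ℕ) : ℤ) h₀).toAdd.toAddMonoidHom.toZModLinearMap 3 with hfdef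
  have hf : ∀ Q, f Q = h₀ • Q := fun Q => rfl
  have hdet : LinearMap.det f = (ℓ : ZMod 3) := W.det_galoisRepTorsion_frobenius_eq 3 hℓ3 hgood hv₁ℓ h𝔓' hh₀
  have hℓm : (ℓ : ZMod 3) = -1 := by
    have h3 : ((ℓ + 1 : ℕ) : ZMod 3) = 0 := by rw [ZMod.natCast_eq_zero_iff]; exact hdvd.1
    rw [Nat.cast_add, Nat.cast_one] at h3
    exact eq_neg_of_add_eq_zero_left h3
  have hnot_id : ¬ ∀ P : geomTorsion W ((3 : ℕ) : ℤ), h₀ • P = P := by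
    intro hall
    have hfid : f = LinearMap.id := LinearMap.ext fun P ↦ by rw [hf, hall]; rfl
    have : LinearMap.det f = 1 := by rw [hfid, LinearMap.det_id]
    rw [hdet, hℓm] at this
    exact hne1 this
  have hnot_neg : ¬ ∀ P : geomTorsion W ((3 : ℕ) : ℤ), h₀ • P = -P := by
    intro hall
    have hfid : f = (-1 : ZMod 3) • LinearMap.id := LinearMap.ext fun P ↦ by
      rw [hf, hall, LinearMap.smul_apply, LinearMap.id_apply, neg_one_smul]
    have : LinearMap.det f = 1 := by
      rw [hfid, LinearMap.det_smul, LinearMap.det_id, h2]; norm_num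
    rw [hdet, hℓm] at this
    exact hne1 this
  obtain ⟨u, hu⟩ := not_forall.mp hnot_neg
  obtain ⟨u', hu'⟩ := not_forall.mp hnot_id
  have ha₁ : h₀ • (h₀ • u + u) = h₀ • u + u := by rw [smul_add, hA2, add_comm]
  have ha₁0 : h₀ • u + u ≠ 0 := fun h0 ↦ hu (eq_neg_of_add_eq_zero_left h0)
  have ha₂ : h₀ • (h₀ • u' - u') = -(h₀ • u' - u') := by rw [smul_sub, hA2, neg_sub]
  have ha₂0 : h₀ • u' - u' ≠ 0 := fun h0 ↦ hu' (sub_eq_zero.mp h0)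
  -- ### conjugate `h₀` into `c₀` on `E[3]`
  have hsurj' : W.HasSurjectiveModNGaloisRep ((3 : ℕ) : ℤ) := hsurj
  obtain ⟨g, hg⟩ := exists_conj_smul_eq_of_involutions W hsurj' ha₁ ha₁0 ha₂ ha₂0 hb₁ hb₁0 hb₂ hb₂0
  set h := g * h₀ * g⁻¹ with hhdef
  have hhP : ∀ P : geomTorsion W 3, h • P = c₀ • P := fun P ↦ by
    rw [hhdef, mul_smul, mul_smul]; exact hg P
  have hhFrob : IsArithFrobAt (𝓞 ℚ) h (g • 𝔓') := hh₀.conj g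
  -- ### on `K`: `h` and `c₀` both restrict to the non-trivial automorphism
  letI : Algebra K (AlgebraicClosure ℚ) := (absEmbedding ℚ K).toRingHom.toAlgebra
  haveI : IsScalarTower ℚ K (AlgebraicClosure ℚ) :=
    IsScalarTower.of_algebraMap_eq fun q ↦ ((absEmbedding ℚ K).commutes q).symm
  let r : absoluteGaloisGroup ℚ →* (K ≃ₐ[ℚ] K) :=
    (AlgEquiv.restrictNormalHom K).comp (absoluteGaloisGroup.toAlgEquiv ℚ).toMonoidHom
  have hr : ∀ (σ : absoluteGaloisGroup ℚ) (x : K), σ • absEmbedding ℚ K x = absEmbedding ℚ K (r σ x) := fun σ x ↦ by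
    have := AlgEquiv.restrictNormal_commutes (absoluteGaloisGroup.toAlgEquiv ℚ σ) K x
    rw [absoluteGaloisGroup.smul_def]
    exact this.symm
  -- `r σ = 1` iff `σ ∈ res Γ_K`
  have hrange : ∀ σ : absoluteGaloisGroup ℚ, r σ = 1 → σ ∈ (absGaloisRestrict ℚ K).range := by
    intro σ hσ
    rw [mem_range_absGaloisRestrict_iff_smul_absEmbedding]
    intro x
    rw [hr, hσ, AlgEquiv.one_apply]
  -- `r h₀ ≠ 1` (`ℓ` inert: residue degree `2`), hence `r h ≠ 1`; `r c₀ ≠ 1` (`K` totally complex)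
  have hf2 := LocalFrob.inertiaDeg_eq_two_of_isPrime_span K hK.1 hℓp hℓP w hw
  have hrh₀ : r h₀ ≠ 1 := by
    intro h1
    obtain ⟨τ, hτ⟩ := MonoidHom.mem_range.mp (hrange h₀ h1)
    have hτ' : absGaloisRestrict ℚ K τ = h₀ := hτ
    have hf1 := inertiaDeg_eq_one_of_isArithFrobAt_absGaloisRestrict (F := ℚ) (M := K) hwv₁ h𝔓 (τ := τ)
      (by rw [hτ']; exact hh₀)
    rw [hf2] at hf1
    exact absurd hf1 (by norm_num)
  have hrc₀ : r c₀ ≠ 1 := fun h1 ↦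
    Rat.not_mem_range_absGaloisRestrict_of_isComplexConjugation K hK.2 hc₀ (hrange c₀ h1)
  have hcard : Nat.card (K ≃ₐ[ℚ] K) = 2 := by rw [IsGalois.card_aut_eq_finrank, hK.1]
  obtain ⟨y, -, hy⟩ := (Nat.card_eq_two_iff' (1 : K ≃ₐ[ℚ] K)).mp hcard
  have hrh : r h = y := by
    have hrh0 : r h₀ = y := hy _ hrh₀
    rw [hhdef, map_mul, map_mul, map_inv, hrh0]
    by_cases hrg : r g = 1
    · rw [hrg, one_mul, inv_one, mul_one]
    · rw [hy _ hrg, mul_inv_cancel_right]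
  have hmem : c₀⁻¹ * h ∈ (absGaloisRestrict ℚ K).range := by
    refine hrange _ ?_
    rw [map_mul, map_inv, hrh, hy _ hrc₀, inv_mul_cancel]
  obtain ⟨τ, hτ⟩ := MonoidHom.mem_range.mp hmem
  have hτ' : absGaloisRestrict ℚ K τ = c₀⁻¹ * h := hτ
  -- ### assemble (3.2)
  refine ⟨v₁, g • 𝔓', h, c₀, hℓv₁, smul_mem_primesAbove h𝔓' g, hhFrob, hc₀, hhP, fun e x ↦ ?_⟩
  have hh' : h = c₀ * absGaloisRestrict ℚ K τ := by rw [hτ', mul_inv_cancel_left]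
  rw [hh', mul_smul, absGaloisRestrict_smul_apply_eq τ e x]

/-- **W. Zhang's Kolyvagin primes at `3` are Gross's Kolyvagin primes** (at an HL-type frame: `K` imaginary quadratic,
`ρ̄_{E,3}` onto): `Zhang2014.IsKolyvaginPrime N W K 3 ℓ → IsKolyvaginPrime N W K 3 ℓ` with `N = N_E`. [cite: GrossLMS1991,
§3 (3.1)–(3.3)] [cite: WZhang2014, Notations (xii)] -/
theorem isKolyvaginPrime_three_of_zhang (hK : IsImaginaryQuadratic K) (hsurj : W.HasSurjectiveModNGaloisRep 3) {ℓ : ℕ}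
    (hℓ : Zhang2014.IsKolyvaginPrime (W.conductorNorm ℤ) W K 3 ℓ) :
    IsKolyvaginPrime (W.conductorNorm ℤ) W K 3 ℓ :=
  ⟨hℓ.1, hℓ.2.1, hℓ.2.2.1, hℓ.2.2.2.1, hℓ.2.2.2.2.1, frobEqFrobInfty_three_of_zhang W K hK hsurj hℓ⟩

end Summit.BirchSwinnertonDyer.Rank1Residual.X11b.Three.Koly.Method2.KolyLocal

end
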